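import Summits.ResolutionOfSingularities.ResolutionOfSingularities.Theorems.FrobeniusLadderFInjectiveMacaulayficationLineCentreEngine
import Summits.ResolutionOfSingularities.ResolutionOfSingularities.Theorems.FrobeniusLadderFInjectiveMacaulayficationASpPinchPoly
import Summits.ResolutionOfSingularities.ResolutionOfSingularities.Theorems.FrobeniusLadderFInjectiveMacaulayficationAS3PinchClosedCentre
import HarnessLib

/-!
# #4β for the `p`-fold Artin–Schreier pinch `y^p + ut^{p-1}y + ut^p` in EVERY characteristic `p`, along its singular line
# (crux `FInjectiveMacaulayfication` stmt-ResolutionOfSingularities-15315, chain w45a, door v30, line WFix under #4β)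

[OURS · L1 W4.5a · res-L1-w45a-lead-1 gen 5] Support file (`--supports stmt-ResolutionOfSingularities-15315 --as helper`); NOT a
statement of any manuscript; AI-written, weaker than expert review.

For EVERY prime `p` and EVERY field `k` of characteristic `p`: `X₁ = Spec k[y,u,t]/(y^p + ut^{p-1}y + ut^p)` (multiplicity `p` along
`D = V(y,t) = Sing X₁`), centre `J = (ȳ, t̄)~`. Chart certificates: chart `y` is the regular surface `1 + uT^{p-1} + uT^p`
(`∂/∂T = −uT^{p-2}` with `u`, `T` units along it); chart `t` is the regular surface `S^p + uS + u` (`∂/∂u = S + 1`, a unit along it);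
off `V(y,t)` the surface is regular (`∂f/∂y = ut^{p-1}` where `u ≠ 0`, `∂f/∂u = t^{p-1}y + t^p` where `u = 0`). Fed to
`LineCentreEngine.closedCentreExists_of_charts(_bad)`: `closedCentreExists_ASp` / `closedCentreExists_ASp_bad` — the conclusion of
door v30's `stub_closedCentreExists` for these `X₁`, uniformly in `p`. [folklore mathematics; OURS as a certificate]
-/

-- single-problem summit: the doubled namespace component is forced
set_option linter.dupNamespace false

noncomputable section

namespace Summit.ResolutionOfSingularities.ResolutionOfSingularities.Theorems.FInjectiveMacaulayfication.ASpPinch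

open AlgebraicGeometry CategoryTheory Literature.AlgebraicGeometry.Resolution MvPolynomial
open Summit.ResolutionOfSingularities.ResolutionOfSingularities.Theorems.FInjectiveMacaulayfication
open Summit.ResolutionOfSingularities.ResolutionOfSingularities.Theorems.FInjectiveMacaulayfication.WildPinchClosedCentre

/-! ## §1 The chart certificates (on), characteristic `m + 2` -/

/-- **Chart `y`: `k[y,u,T]/(1 + uT^{m+1} + uT^{m+2})` satisfies the clause at every maximal ideal** (characteristic `m + 2`;
`∂/∂T = −uT^m`, and `u`, `T` are units modulo every prime: `1 = g₀ − u(T^{m+1} + T^{m+2}) = g₀ − T(uT^m + uT^{m+1})`). [folklore] -/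
theorem hon₀ (k : Type) [Field k] (m : ℕ) [CharP k (m + 2)] [Fact (Nat.Prime (m + 2))]
    (Q' : Ideal (MvPolynomial (Fin 3) k ⧸ Ideal.span {(1 + X 1 * X 2 ^ (m + 1) + X 1 * X 2 ^ (m + 2) : MvPolynomial (Fin 3) k)}))
    [Q'.IsMaximal] :
    ∀ d : ℕ, ringKrullDim (Localization.AtPrime Q') = d → ∀ s : Fin d → Localization.AtPrime Q',
      (Ideal.span (Set.range s)).radical.IsMaximal →
        RingTheory.Sequence.IsWeaklyRegular (Localization.AtPrime Q') (List.ofFn s) ∧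
        ∀ y : Localization.AtPrime Q', (∃ e : ℕ, y ^ (m + 2) ^ e ∈ Ideal.span
          ((fun z : Localization.AtPrime Q' => z ^ (m + 2) ^ e) ''
            (Ideal.span (Set.range s) : Set (Localization.AtPrime Q')))) → y ∈ Ideal.span (Set.range s) := by
  refine ClauseOfPderivNotMem.stub_clauseOfPderivNotMem (m + 2) k 3 _ Q' 2 ?_
  rw [pderiv_two_g0 k m]
  intro h
  rw [Ideal.neg_mem_iff] at h
  have hP : (Q'.comap (Ideal.Quotient.mk
      (Ideal.span {(1 + X 1 * X 2 ^ (m + 1) + X 1 * X 2 ^ (m + 2) : MvPolynomial (Fin 3) k)}))).IsPrime :=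
    Ideal.comap_isPrime _ _
  have hg := AS3Pinch.self_mem_comap (1 + X 1 * X 2 ^ (m + 1) + X 1 * X 2 ^ (m + 2) : MvPolynomial (Fin 3) k) Q'
  rcases hP.mem_or_mem h with h1 | h2
  · have hmem := sub_mem hg (Ideal.mul_mem_right (X 2 ^ (m + 1) + X 2 ^ (m + 2)) _ h1)
    rw [show (1 + X 1 * X 2 ^ (m + 1) + X 1 * X 2 ^ (m + 2) : MvPolynomial (Fin 3) k) - X 1 * (X 2 ^ (m + 1) + X 2 ^ (m + 2)) = 1
      by ring] at hmem
    exact hP.ne_top ((Ideal.eq_top_iff_one _).mpr hmem)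
  · have h2' := hP.mem_of_pow_mem m h2
    have hmem := sub_mem hg (Ideal.mul_mem_right (X 1 * X 2 ^ m + X 1 * X 2 ^ (m + 1)) _ h2')
    rw [show (1 + X 1 * X 2 ^ (m + 1) + X 1 * X 2 ^ (m + 2) : MvPolynomial (Fin 3) k) - X 2 * (X 1 * X 2 ^ m + X 1 * X 2 ^ (m + 1)) = 1
      by ring] at hmem
    exact hP.ne_top ((Ideal.eq_top_iff_one _).mpr hmem)

/-- **Chart `t`: `k[S,u,t]/(S^{m+2} + uS + u)` satisfies the clause at every maximal ideal** (`∂/∂u = S + 1`, a unit modulo every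
prime: `S^{m+2} = g₁ − u(S + 1)`). [folklore] -/
theorem hon₁ (k : Type) [Field k] (m : ℕ) [CharP k (m + 2)] [Fact (Nat.Prime (m + 2))]
    (Q' : Ideal (MvPolynomial (Fin 3) k ⧸ Ideal.span {(X 0 ^ (m + 2) + X 1 * X 0 + X 1 : MvPolynomial (Fin 3) k)})) [Q'.IsMaximal] :
    ∀ d : ℕ, ringKrullDim (Localization.AtPrime Q') = d → ∀ s : Fin d → Localization.AtPrime Q',
      (Ideal.span (Set.range s)).radical.IsMaximal →
        RingTheory.Sequence.IsWeaklyRegular (Localization.AtPrime Q') (List.ofFn s) ∧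
        ∀ y : Localization.AtPrime Q', (∃ e : ℕ, y ^ (m + 2) ^ e ∈ Ideal.span
          ((fun z : Localization.AtPrime Q' => z ^ (m + 2) ^ e) ''
            (Ideal.span (Set.range s) : Set (Localization.AtPrime Q')))) → y ∈ Ideal.span (Set.range s) := by
  refine ClauseOfPderivNotMem.stub_clauseOfPderivNotMem (m + 2) k 3 _ Q' 1 ?_
  rw [pderiv_one_g1 k m]
  intro h
  have hP : (Q'.comap (Ideal.Quotient.mk (Ideal.span {(X 0 ^ (m + 2) + X 1 * X 0 + X 1 : MvPolynomial (Fin 3) k)}))).IsPrime :=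
    Ideal.comap_isPrime _ _
  have hg := AS3Pinch.self_mem_comap (X 0 ^ (m + 2) + X 1 * X 0 + X 1 : MvPolynomial (Fin 3) k) Q'
  have hX0 : (X 0 : MvPolynomial (Fin 3) k) ∈
      Q'.comap (Ideal.Quotient.mk (Ideal.span {(X 0 ^ (m + 2) + X 1 * X 0 + X 1 : MvPolynomial (Fin 3) k)})) := by
    refine hP.mem_of_pow_mem (m + 2) ?_
    have hmem := sub_mem hg (Ideal.mul_mem_left _ (X 1) h)
    rwa [show (X 0 ^ (m + 2) + X 1 * X 0 + X 1 : MvPolynomial (Fin 3) k) - X 1 * (X 0 + 1) = X 0 ^ (m + 2) by ring] at hmem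
  have hmem := sub_mem h hX0
  rw [show (X 0 + 1 : MvPolynomial (Fin 3) k) - X 0 = 1 by ring] at hmem
  exact hP.ne_top ((Ideal.eq_top_iff_one _).mpr hmem)

/-- The two chart certificates packaged over `c : Fin 2` in the engine's binder shape. -/
theorem hon (k : Type) [Field k] (m : ℕ) [CharP k (m + 2)] [Fact (Nat.Prime (m + 2))] : ∀ (c : Fin 2)
    (Q' : Ideal (MvPolynomial (Fin 3) k ⧸ Ideal.span
      {(![1 + X 1 * X 2 ^ (m + 1) + X 1 * X 2 ^ (m + 2), X 0 ^ (m + 2) + X 1 * X 0 + X 1] c : MvPolynomial (Fin 3) k)})) [Q'.IsMaximal],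
    Ideal.Quotient.mk _ (X (Fan02of3.jc c)) ∈ Q' →
      ∀ d : ℕ, ringKrullDim (Localization.AtPrime Q') = d → ∀ s : Fin d → Localization.AtPrime Q',
        (Ideal.span (Set.range s)).radical.IsMaximal →
          RingTheory.Sequence.IsWeaklyRegular (Localization.AtPrime Q') (List.ofFn s) ∧
          ∀ y : Localization.AtPrime Q', (∃ e : ℕ, y ^ (m + 2) ^ e ∈ Ideal.span
            ((fun z : Localization.AtPrime Q' => z ^ (m + 2) ^ e) ''
              (Ideal.span (Set.range s) : Set (Localization.AtPrime Q')))) → y ∈ Ideal.span (Set.range s) := by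
  intro c Q' hQ' _
  fin_cases c
  · exact @hon₀ k _ m _ _ Q' hQ'
  · exact @hon₁ k _ m _ _ Q' hQ'

/-! ## §2 The base certificate (off) -/

/-- **Off `V(y,t)` the surface `y^{m+2} + ut^{m+1}y + ut^{m+2} = 0` satisfies the clause** at every maximal `Q ⊉ (ȳ, t̄)`: `t ∉ Q`
(else `y^{m+2} ∈ Q`); if `u ∉ Q` use `∂f/∂y = ut^{m+1}`, if `u ∈ Q` then `y ∈ Q` and `∂f/∂u = t^{m+1}y + t^{m+2} ∉ Q`. [folklore] -/
theorem hoff (k : Type) [Field k] (m : ℕ) [CharP k (m + 2)] [Fact (Nat.Prime (m + 2))] (f : MvPolynomial (Fin 3) k)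
    (hf : f = X 0 ^ (m + 2) + X 1 * X 2 ^ (m + 1) * X 0 + X 1 * X 2 ^ (m + 2))
    (Q : Ideal (MvPolynomial (Fin 3) k ⧸ Ideal.span {f})) [Q.IsMaximal]
    (hQ : ¬ Ideal.span {Ideal.Quotient.mk (Ideal.span {f}) (X 0), Ideal.Quotient.mk (Ideal.span {f}) (X 2)} ≤ Q) :
    ∀ d : ℕ, ringKrullDim (Localization.AtPrime Q) = d → ∀ s : Fin d → Localization.AtPrime Q,
      (Ideal.span (Set.range s)).radical.IsMaximal →
        RingTheory.Sequence.IsWeaklyRegular (Localization.AtPrime Q) (List.ofFn s) ∧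
        ∀ y : Localization.AtPrime Q, (∃ e : ℕ, y ^ (m + 2) ^ e ∈ Ideal.span
          ((fun z : Localization.AtPrime Q => z ^ (m + 2) ^ e) ''
            (Ideal.span (Set.range s) : Set (Localization.AtPrime Q)))) → y ∈ Ideal.span (Set.range s) := by
  have hP : (Q.comap (Ideal.Quotient.mk (Ideal.span {f}))).IsPrime := Ideal.comap_isPrime _ _
  have hfP := AS3Pinch.self_mem_comap f Q
  have hX2 : (X 2 : MvPolynomial (Fin 3) k) ∉ Q.comap (Ideal.Quotient.mk (Ideal.span {f})) := by
    intro h2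
    have hX0 : (X 0 : MvPolynomial (Fin 3) k) ∈ Q.comap (Ideal.Quotient.mk (Ideal.span {f})) := by
      refine hP.mem_of_pow_mem (m + 2) ?_
      have hmem := sub_mem hfP (Ideal.mul_mem_right (X 1 * X 2 ^ m * X 0 + X 1 * X 2 ^ (m + 1)) _ h2)
      rwa [show f - X 2 * (X 1 * X 2 ^ m * X 0 + X 1 * X 2 ^ (m + 1)) = X 0 ^ (m + 2) by rw [hf]; ring] at hmem
    refine hQ (Ideal.span_le.mpr ?_)
    rintro _ (rfl | rfl)
    · exact Ideal.mem_comap.mp hX0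
    · exact Ideal.mem_comap.mp h2
  by_cases h1 : (X 1 : MvPolynomial (Fin 3) k) ∈ Q.comap (Ideal.Quotient.mk (Ideal.span {f}))
  · -- `u ∈ Q`: then `y ∈ Q`, and `∂f/∂u = t^{m+1}y + t^{m+2} ∉ Q`
    have hX0 : (X 0 : MvPolynomial (Fin 3) k) ∈ Q.comap (Ideal.Quotient.mk (Ideal.span {f})) := by
      refine hP.mem_of_pow_mem (m + 2) ?_
      have hmem := sub_mem hfP (Ideal.mul_mem_right (X 2 ^ (m + 1) * X 0 + X 2 ^ (m + 2)) _ h1)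
      rwa [show f - X 1 * (X 2 ^ (m + 1) * X 0 + X 2 ^ (m + 2)) = X 0 ^ (m + 2) by rw [hf]; ring] at hmem
    refine ClauseOfPderivNotMem.stub_clauseOfPderivNotMem (m + 2) k 3 f Q 1 ?_
    rw [pderiv_one_f k m f hf]
    intro h
    have hmem := sub_mem h (Ideal.mul_mem_left _ (X 2 ^ (m + 1)) hX0)
    rw [show (X 2 ^ (m + 1) * X 0 + X 2 ^ (m + 2) : MvPolynomial (Fin 3) k) - X 2 ^ (m + 1) * X 0 = X 2 ^ (m + 2) by ring] at hmem
    exact hX2 (hP.mem_of_pow_mem (m + 2) hmem)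
  · -- `u ∉ Q`: `∂f/∂y = ut^{m+1} ∉ Q`
    refine ClauseOfPderivNotMem.stub_clauseOfPderivNotMem (m + 2) k 3 f Q 0 ?_
    rw [pderiv_zero_f k m f hf]
    intro h
    rcases hP.mem_or_mem h with h1' | h2
    · exact h1 h1'
    · exact hX2 (hP.mem_of_pow_mem (m + 1) h2)

/-! ## §3 #4β for the family, uniformly in the prime `p` -/

/-- **#4β FOR `X₁ = Spec k[y,u,t]/(y^p + ut^{p-1}y + ut^p)` IN EVERY CHARACTERISTIC `p`, WITH CENTRE THE REDUCED SINGULAR LINE `(ȳ, t̄)`,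
AT EVERY POINT OF `V(ȳ, t̄)`**: one call to `LineCentreEngine.closedCentreExists_of_charts` (with `p = m + 2`).
[folklore mathematics; OURS as a certificate] -/
theorem closedCentreExists_ASp (p : ℕ) [hp : Fact p.Prime] (k : Type) [Field k] [CharP k p] (f : MvPolynomial (Fin 3) k)
    (hf : f = X 0 ^ p + X 1 * X 2 ^ (p - 1) * X 0 + X 1 * X 2 ^ p)
    (I : Ideal (MvPolynomial (Fin 3) k ⧸ Ideal.span {f}))
    (hI : I = Ideal.span {Ideal.Quotient.mk (Ideal.span {f}) (X 0), Ideal.Quotient.mk (Ideal.span {f}) (X 2)})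
    (b : ↥(Spec (.of (MvPolynomial (Fin 3) k ⧸ Ideal.span {f})))) (hb : I ≤ b.asIdeal) :
    ∃ J : (Spec (.of (MvPolynomial (Fin 3) k ⧸ Ideal.span {f}))).IdealSheafData, J ≠ ⊥ ∧
      b ∈ (J.support : Set ↥(Spec (.of (MvPolynomial (Fin 3) k ⧸ Ideal.span {f})))) ∧
      ∀ (X' : Scheme.{0}) (π : X' ⟶ Spec (.of (MvPolynomial (Fin 3) k ⧸ Ideal.span {f}))),
        Literature.AlgebraicGeometry.Resolution.IsBlowup π J →
        ∀ x' : X', π.base x' ∈ (J.support : Set ↥(Spec (.of (MvPolynomial (Fin 3) k ⧸ Ideal.span {f})))) →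
          IsDomain (X'.presheaf.stalk x') ∧ ∀ d : ℕ, ringKrullDim (X'.presheaf.stalk x') = d →
            ∀ s : Fin d → X'.presheaf.stalk x', (Ideal.span (Set.range s)).radical.IsMaximal →
              RingTheory.Sequence.IsWeaklyRegular (X'.presheaf.stalk x') (List.ofFn s) ∧
              ∀ z : X'.presheaf.stalk x', (∃ e : ℕ, z ^ p ^ e ∈
                  Ideal.span ((fun w : X'.presheaf.stalk x' => w ^ p ^ e) ''
                    (Ideal.span (Set.range s) : Set (X'.presheaf.stalk x')))) → z ∈ Ideal.span (Set.range s) := by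
  obtain ⟨m, rfl⟩ : ∃ m, p = m + 2 := ⟨p - 2, by have := hp.out.two_le; omega⟩
  rw [show m + 2 - 1 = m + 1 by omega] at hf
  exact LineCentreEngine.closedCentreExists_of_charts (m + 2) k f (prime_ASp k m f hf).1 (fun c => (prime_ASp k m f hf).2 _)
    (fun _ => m + 2) ![1 + X 1 * X 2 ^ (m + 1) + X 1 * X 2 ^ (m + 2), X 0 ^ (m + 2) + X 1 * X 0 + X 1] (theta k m f hf) (hcop k m)
    (hon k m) (hoff k m f hf) I hI b hb

/-- **#4β FOR `X₁ = Spec k[y,u,t]/(y^p + ut^{p-1}y + ut^p)` IN EVERY CHARACTERISTIC `p`, AT EVERY CLOSED BAD POINT** — the body of door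
v30's `stub_closedCentreExists` for these `X₁`: one call to `LineCentreEngine.closedCentreExists_of_charts_bad`. [OURS as a certificate] -/
theorem closedCentreExists_ASp_bad (p : ℕ) [hp : Fact p.Prime] (k : Type) [Field k] [CharP k p] (f : MvPolynomial (Fin 3) k)
    (hf : f = X 0 ^ p + X 1 * X 2 ^ (p - 1) * X 0 + X 1 * X 2 ^ p)
    (b : ↥(Spec (.of (MvPolynomial (Fin 3) k ⧸ Ideal.span {f}))))
    (hb : IsClosed ({b} : Set ↥(Spec (.of (MvPolynomial (Fin 3) k ⧸ Ideal.span {f})))))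
    (hbad : ¬ ∀ d : ℕ, ringKrullDim ((Spec (.of (MvPolynomial (Fin 3) k ⧸ Ideal.span {f}))).presheaf.stalk b) = d →
      ∀ s : Fin d → (Spec (.of (MvPolynomial (Fin 3) k ⧸ Ideal.span {f}))).presheaf.stalk b,
        (Ideal.span (Set.range s)).radical.IsMaximal →
          ∀ y : (Spec (.of (MvPolynomial (Fin 3) k ⧸ Ideal.span {f}))).presheaf.stalk b, (∃ e : ℕ, y ^ p ^ e ∈
            Ideal.span ((fun z : (Spec (.of (MvPolynomial (Fin 3) k ⧸ Ideal.span {f}))).presheaf.stalk b => z ^ p ^ e) ''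
              (Ideal.span (Set.range s) : Set ((Spec (.of (MvPolynomial (Fin 3) k ⧸ Ideal.span {f}))).presheaf.stalk b)))) →
            y ∈ Ideal.span (Set.range s)) :
    ∃ J : (Spec (.of (MvPolynomial (Fin 3) k ⧸ Ideal.span {f}))).IdealSheafData, J ≠ ⊥ ∧
      b ∈ (J.support : Set ↥(Spec (.of (MvPolynomial (Fin 3) k ⧸ Ideal.span {f})))) ∧
      ∀ (X' : Scheme.{0}) (π : X' ⟶ Spec (.of (MvPolynomial (Fin 3) k ⧸ Ideal.span {f}))),
        Literature.AlgebraicGeometry.Resolution.IsBlowup π J →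
        ∀ x' : X', π.base x' ∈ (J.support : Set ↥(Spec (.of (MvPolynomial (Fin 3) k ⧸ Ideal.span {f})))) →
          IsDomain (X'.presheaf.stalk x') ∧ ∀ d : ℕ, ringKrullDim (X'.presheaf.stalk x') = d →
            ∀ s : Fin d → X'.presheaf.stalk x', (Ideal.span (Set.range s)).radical.IsMaximal →
              RingTheory.Sequence.IsWeaklyRegular (X'.presheaf.stalk x') (List.ofFn s) ∧
              ∀ z : X'.presheaf.stalk x', (∃ e : ℕ, z ^ p ^ e ∈
                  Ideal.span ((fun w : X'.presheaf.stalk x' => w ^ p ^ e) ''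
                    (Ideal.span (Set.range s) : Set (X'.presheaf.stalk x')))) → z ∈ Ideal.span (Set.range s) := by
  obtain ⟨m, rfl⟩ : ∃ m, p = m + 2 := ⟨p - 2, by have := hp.out.two_le; omega⟩
  rw [show m + 2 - 1 = m + 1 by omega] at hf
  exact LineCentreEngine.closedCentreExists_of_charts_bad (m + 2) k f (prime_ASp k m f hf).1 (fun c => (prime_ASp k m f hf).2 _)
    (fun _ => m + 2) ![1 + X 1 * X 2 ^ (m + 1) + X 1 * X 2 ^ (m + 2), X 0 ^ (m + 2) + X 1 * X 0 + X 1] (theta k m f hf) (hcop k m)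
    (hon k m) (hoff k m f hf) b hb hbad

end Summit.ResolutionOfSingularities.ResolutionOfSingularities.Theorems.FInjectiveMacaulayfication.ASpPinch
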